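import Literature.AnabelianGeometry.EtaleTheta.SettingModelChiCoverings
import HarnessLib

/-!
# The UNTWISTED KRULL model of the [EtTh] §1 root, file K1a: the trivial twist `actκ := θ ∘ 1` on `Γ`, its twist
# data, and the coverings `Π^tp_{Y_N}`, `Π^tp_{Z_N} ≤ Γ ⋊_{actκ} G_{ℚ_p}`

Mochizuki, *The étale theta function …*, Publ. RIMS **45** (2009) [EtTh], §1, PRIMS PDF pp. 12–14
[cite: MochizukiEtTh2009, §1 p.13]: «`K_N := K(ζ_N, q_X^{1/N})`», «`Δ^tp_Y/Δ^tp_{Y_N} ≅ ℤ/Nℤ(1)`»,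
«`Gal(Z_N/Y_N) ≅ ℤ/Nℤ(1)`». Cell abc-iut, layer L2, seat abc-iut-L2-t10 (gen 5), row «coverDataAx FULLY
INSTANTIATED» (STATUS 10:51Z/11:08Z). WHY A NEW MODEL: the binder hIx of `PiCData.coverDataAx` («`I_x ⥲ Δ̄_Θ`»)
needs a cusp on the COMMUTATOR axis AND (P1) `Ker(Π_X → G_K) = Δ̂_X` with a compact decomposition group; the
χ-twisted models have (P1) but only the TORAL cusp (hIx FAILS, p433801/p437157), abc-iut-w5-d165's `model₂ᶜ` has the
commutator cusp but a DISCRETE Galois factor (no (P1), `D_x` not compact). The untwisted Krull model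
`Π^tp_X := Γ ⋊_{θ∘1} G_{ℚ_p}` — abc-iut-L2-t1's χ-model transcribed with the cyclotomic character replaced by the
TRIVIAL homomorphism `1 : G_{ℚ_p} → Ẑ^×` — has both. This file = the F5a transcript (`SettingModelChiCoverings`, χ ↦ 1):

* `actκ p := twistGfp.comp (1 : G_{ℚ_p} →* Aut Ẑ)` (so that abc-iut-w5-d072's `twistedInversion 1` typechecks
  later), `actκ_apply_eq : actκ p σ γ = γ`; `krullTwistData : GfpTwistData (actκ p)` (level shadow `diagTwist 1 = id`);
* `YNκ N`, `ZNκ N` (generic `GfpTwistData.YN/ZN` with `B := G_{K_N}`, `G_{J_N}`), normal, antitone, with the printed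
  images and indices, open for the induced topology — every clause BY NAME from abc-iut-L2-t1's generic API.

SEMI-SYNTHETIC MODEL (consistency evidence only; NOT the tempered `π₁` of a curve; the Galois action on `Γ` is
TRIVIAL — it serves the §2 cover/cusp-position layer, not the Tate/Kummer clauses). Class (b) construction; nothing of
[EtTh] asserted; no side taken on [IUTchIII] Cor. 3.12; typed ≠ proved.
-/

noncomputable section

namespace Literature.AnabelianGeometry.EtaleTheta.SettingModel

open Literature.AnabelianGeometry.SemiGraphs
open Function

variable (p : ℕ) [Fact p.Prime]

/-! ### The trivial twist and its twist data -/

/-- **`G_{ℚ_p} → Aut Γ`, `σ ↦ θ_{1} = id`** — written as `twistGfp ∘ 1` (not the literal `1`) so that the twisted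
semidirect-product API applies verbatim. [cite: MochizukiEtTh2009, §1 p.12] -/
abbrev actκ : GQp p →* MulAut Gfp := twistGfp.comp (1 : GQp p →* MulAut ZH)

/-- [cite: MochizukiEtTh2009, §1 p.12] -/
theorem actκ_apply (σ : GQp p) (γ : Gfp) : actκ p σ γ = twistGfp ((1 : GQp p →* MulAut ZH) σ) γ := rfl

/-- The action is TRIVIAL: `actκ p σ γ = γ` (`θ_1 = id`). [cite: MochizukiEtTh2009, §1 p.12] -/
theorem actκ_apply_eq (σ : GQp p) (γ : Gfp) : actκ p σ γ = γ := by
  rw [actκ_apply, MonoidHom.one_apply, map_one, MulAut.one_apply]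

/-- **The twist data of `actκ`**: degree preserved; level-`N` shadow `diagTwist (χ_N 1) = id`.
[cite: MochizukiEtTh2009, §1 p.13] -/
def krullTwistData : GfpTwistData (actκ p) where
  hdeg σ γ := gfpSnd_twistGfp ((1 : GQp p →* MulAut ZH) σ) γ
  δ N σ := Heis.diagTwist (ZHatLevel.levelChar N ((1 : GQp p →* MulAut ZH) σ))
  δ_zAxis N σ h hh := by
    obtain ⟨hx, hy⟩ := hh
    refine ⟨?_, ?_⟩
    · show (Heis.diagTwist _ h).x = 0
      rw [Heis.diagTwist_apply]; exact hx
    · show (Heis.diagTwist _ h).y = 0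
      rw [Heis.diagTwist_apply]
      show _ * h.y = 0
      rw [hy, mul_zero]
  δ_one N σ := map_one _
  hlev N σ γ := hHat_gfpFst_twistGfp N ((1 : GQp p →* MulAut ZH) σ) γ

/-- The level shadow is the IDENTITY (`χ_N(1) = 1`). [cite: MochizukiEtTh2009, §1 p.13] -/
theorem krullTwistData_δ_eq_self (N : ℕ+) (σ : GQp p) (h : Heis (ZMod N)) : (krullTwistData p).δ N σ h = h := by
  change Heis.diagTwist (ZHatLevel.levelChar N ((1 : GQp p →* MulAut ZH) σ)) h = h
  rw [MonoidHom.one_apply, map_one, Heis.diagTwist_apply, one_mul, one_mul]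

/-! ### The coverings (`K := ℚ_p`, `q_X := p²`) -/

/-- **`Π^tp_{Y_N} := Δ^tp_{Y_N} ⋊ G_{K_N} ≤ Γ ⋊_{actκ} G_{ℚ_p}`**. [cite: MochizukiEtTh2009, §1 p.13] -/
def YNκ (N : ℕ+) : Subgroup (Gfp ⋊[actκ p] GQp p) :=
  (krullTwistData p).YN N (fieldKN ⊥ (qModel p) N).fixingSubgroup

/-- **`Π^tp_{Z_N} := Δ^tp_{Z_N} ⋊ G_{J_N}`**. [cite: MochizukiEtTh2009, §1 p.14] -/
def ZNκ (N : ℕ+) : Subgroup (Gfp ⋊[actκ p] GQp p) :=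
  (krullTwistData p).ZN N (fieldJN ⊥ (qModel p) N).fixingSubgroup

/-- `Π^tp_{Y_N}` is normal. [cite: MochizukiEtTh2009, §1 p.14] -/
theorem YNκ_normal (N : ℕ+) : (YNκ p N).Normal := by
  haveI := fixingSubgroup_fieldKN_bot_normal _ (qModel_mem_botχ p) N
  exact (krullTwistData p).YN_normal N _ (fun σ _ h => krullTwistData_δ_eq_self p N σ h)

/-- `Π^tp_{Z_N}` is normal. [cite: MochizukiEtTh2009, §1 p.15] -/
theorem ZNκ_normal (N : ℕ+) : (ZNκ p N).Normal := by
  haveI := fixingSubgroup_fieldJN_bot_normal _ (qModel_mem_botχ p) N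
  exact (krullTwistData p).ZN_normal N _ (fun σ _ h => krullTwistData_δ_eq_self p N σ h)

/-- `Π^tp_{Y_1} = Π^tp_Y = Ker(Π^tp_X ↠ Z)`. [cite: MochizukiEtTh2009, §1 p.14] -/
theorem YNκ_one : YNκ p 1 = (krullTwistData p).toZ.ker := by
  rw [← GfpTwistData.YN_one_top]
  unfold YNκ GfpTwistData.YN
  exact Semidirect.twistedProd_eq_of_eq rfl
    (by rw [fieldKN_bot_one _ (qModel_mem_botχ p), IntermediateField.fixingSubgroup_bot])

/-- [cite: MochizukiEtTh2009, §1 p.13] -/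
theorem YNκ_le (N : ℕ+) : YNκ p N ≤ (krullTwistData p).toZ.ker := (krullTwistData p).YN_le N _

/-- [cite: MochizukiEtTh2009, §1 p.14] -/
theorem ZNκ_le_YNκ (N : ℕ+) : ZNκ p N ≤ YNκ p N :=
  (krullTwistData p).ZN_le_YN N (IntermediateField.fixingSubgroup_antitone (fieldKN_le_fieldJN _ ⊥ N))

/-- [cite: MochizukiEtTh2009, §1 p.18] -/
theorem YNκ_anti {M N : ℕ+} (h : (M : ℕ) ∣ N) : YNκ p N ≤ YNκ p M :=
  (krullTwistData p).YN_anti h (IntermediateField.fixingSubgroup_antitone (fieldKN_bot_mono _ (qModel_ne_zeroχ p) h))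

/-- [cite: MochizukiEtTh2009, §1 p.18] -/
theorem ZNκ_anti {M N : ℕ+} (h : (M : ℕ) ∣ N) : ZNκ p N ≤ ZNκ p M :=
  (krullTwistData p).ZN_anti h (IntermediateField.fixingSubgroup_antitone (fieldJN_bot_mono _ (qModel_ne_zeroχ p) h))

/-- `Π^tp_{Y_N} ↠ G_{K_N}`. [cite: MochizukiEtTh2009, §1 p.13] -/
theorem map_rightHom_YNκ (N : ℕ+) :
    (YNκ p N).map SemidirectProduct.rightHom = (fieldKN ⊥ (qModel p) N).fixingSubgroup :=
  (krullTwistData p).map_rightHom_YN N _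

/-- `Π^tp_{Z_N} ↠ G_{J_N}`. [cite: MochizukiEtTh2009, §1 p.14] -/
theorem map_rightHom_ZNκ (N : ℕ+) :
    (ZNκ p N).map SemidirectProduct.rightHom = (fieldJN ⊥ (qModel p) N).fixingSubgroup :=
  (krullTwistData p).map_rightHom_ZN N _

/-- `[Δ^tp_Y : Δ^tp_{Y_N}] = N`. [cite: MochizukiEtTh2009, §1 p.13] -/
theorem relIndex_YNκ (N : ℕ+) :
    (YNκ p N ⊓ SemidirectProduct.rightHom.ker).relIndex ((krullTwistData p).toZ.ker ⊓ SemidirectProduct.rightHom.ker) = N :=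
  (krullTwistData p).relIndex_YN N _

/-- `[Δ^tp_{Y_N} : Δ^tp_{Z_N}] = N`. [cite: MochizukiEtTh2009, §1 p.14] -/
theorem relIndex_ZNκ (N : ℕ+) :
    (ZNκ p N ⊓ SemidirectProduct.rightHom.ker).relIndex (YNκ p N ⊓ SemidirectProduct.rightHom.ker) = N :=
  (krullTwistData p).relIndex_ZN N _ _

/-- `Π^tp_{Y_N}` is open for any topology making `(left, right)` continuous. [cite: MochizukiEtTh2009, §1 p.13] -/
theorem isOpen_YNκ [TopologicalSpace (Gfp ⋊[actκ p] GQp p)]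
    (hc : Continuous fun g : Gfp ⋊[actκ p] GQp p => (g.left, g.right)) (N : ℕ+)
    (hK : IsOpen ((fieldKN ⊥ (qModel p) N).fixingSubgroup : Set (GQp p))) :
    IsOpen (YNκ p N : Set (Gfp ⋊[actκ p] GQp p)) :=
  (krullTwistData p).isOpen_YN hc N hK

/-- `Π^tp_{Z_N}` is open under the same provisos. [cite: MochizukiEtTh2009, §1 p.14] -/
theorem isOpen_ZNκ [TopologicalSpace (Gfp ⋊[actκ p] GQp p)]
    (hc : Continuous fun g : Gfp ⋊[actκ p] GQp p => (g.left, g.right)) (N : ℕ+)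
    (hJ : IsOpen ((fieldJN ⊥ (qModel p) N).fixingSubgroup : Set (GQp p))) :
    IsOpen (ZNκ p N : Set (Gfp ⋊[actκ p] GQp p)) :=
  (krullTwistData p).isOpen_ZN hc N hJ

end Literature.AnabelianGeometry.EtaleTheta.SettingModel

end
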